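/-
Copyright (c) 2026 the pub-hodgecm-mathlib formalisation cell (harness21).  Prover seat hodgecm-mathlib-K2E3-p17 (g8), Track B «K2-LIT» / h413
(`stmt-HodgeConjecture-24833`), line `K2_E3_EllipticInputs`, leaf (nsc-S-A'), D94 brick IRR''-a (CENSUS v0.2 §7): the exponents of `D'' = Ind_Q(η∘det₂ ⊗ ην^(1/2))` read off ★ GEO-QB.
2026-09-04.
-/
import Summits.HodgeConjecture.HodgeConjecture.Theorems.K2E3GL3StandardModuleJacquetDimension   -- ★ GEO-QB (K2E5-p17): `finrank_weightSpace_normalizedJacquetGL_D`, `finiteDimensional_jacquet_D`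
import Summits.HodgeConjecture.HodgeConjecture.Theorems.K2E3GL3PrincipalSeriesRegular           -- ★ REG (K2E3-p23): `eq_of_tch_coe_eq`, `mul_nuHalf_inv_ne_mul_nuHalf`
import HarnessLib

/-!
# Crux `H413` — leaf (nsc-S-A′), brick IRR″-a: THE EXPONENTS OF `D″ = D(η, ην½)` — `E(D″) = {X², Y}`

Cell `hodgecm-mathlib`, Track B; THEOREMS ONLY; count-neutral helper (`--supports stmt-HodgeConjecture-24833 --as helper`).  Letters (C1″, support `{a, aν, aν}`, `a = ην½⁻¹`,
`aν = ην½`): `X = tch(a, aν, aν)`, `Y = tch(aν, a, aν)`; `D″` = ★ STD-EMB's `D η (ην½)` spelled `parabolicIndGL F ![f,f,t] (𝟙.twist ψ_Q)`.  ★ GEO-QB's count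
`mult (D η ψ) ζ = #{w ∈ {1, s₂, s₁s₂} : ζ = tch(θ_D ∘ w⁻¹)}` evaluated at `ψ = ην½` (`θ_D = (a, aν, aν)`: `w = 1, s₂ ↦ X`, `w = s₁s₂ ↦ Y`):
**`finrank_weightSpace_D_high_X = 2`, `finrank_weightSpace_D_high_Y = 1`, `finrank_weightSpace_D_high_eq_zero` (every other `ζ`)**.  Input of IRR″ (D″ irreducible) and CASES.

HONEST LABEL: HC_CM is proved only modulo the 7 printed citations (2 remaining named inputs: hLiu418 = stmt-HodgeConjecture-24832, h413 =
stmt-HodgeConjecture-24833) until rung 0 closes; count-neutral helper.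

## References
* [BernsteinZelevinsky1977] I. N. Bernstein, A. V. Zelevinsky, *Induced representations of reductive p-adic groups I*, Ann. Sci. ÉNS 10 (1977), §2.12, Thm. 5.2.
* [Zelevinsky1980] A. V. Zelevinsky, *Induced representations of reductive p-adic groups II*, Ann. Sci. ÉNS 13 (1980), §1.2, §1.6, Ex. 3.2.
-/

set_option autoImplicit false
-- the mandated namespace repeats `HodgeConjecture.HodgeConjecture`, as in every `Theorems/*.lean` of this sub-problem
set_option linter.dupNamespace false

noncomputable section

open Module Representation Literature.NumberTheory.Automorphic Literature.NumberTheory.GaloisRepresentations.IsNonarchimedeanLocalField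
open scoped MatrixGroups NNReal
open Summit.HodgeConjecture.HodgeConjecture.Cruxes.H413.K2E3GL3StandardModuleJacquetDimension (finrank_weightSpace_normalizedJacquetGL_D finiteDimensional_jacquet_D)
open Summit.HodgeConjecture.HodgeConjecture.Cruxes.H413.K2E3GL3PrincipalSeriesRegular (eq_of_tch_coe_eq mul_nuHalf_inv_ne_mul_nuHalf)

namespace Summit.HodgeConjecture.HodgeConjecture.Cruxes.H413.K2E3GL3OneLinkNestedHighPieces

variable {F : Type} [Field F] [ValuativeRel F] [TopologicalSpace F] [IsNonarchimedeanLocalField F] (η : Fˣ →* ℂˣ)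

/-- `aν = ην½` has open kernel. [folklore] -/
theorem isOpen_ker_b (hη : IsOpen ((η.ker : Subgroup Fˣ) : Set Fˣ)) : IsOpen ((((η * ((unramifiedTwist F (1 / 2) : QuasiChar F).toMonoidHom))).ker : Subgroup Fˣ) : Set Fˣ) :=
  K2E3GL3StandardModuleEmbedding.isOpen_ker_mul_of_isOpen hη K2E3GL3StandardModuleEmbedding.isOpen_ker_nuHalf

omit [ValuativeRel F] [TopologicalSpace F] [IsNonarchimedeanLocalField F] in
/-- `tch` of a reordered triple is `tch` of the explicit vector (★ GEO-QB's filter predicate ↦ ★ H0's `tch ![·,·,·]` currency). [folklore] -/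
theorem tch_reorder_eq (θ : Fin 3 → (Fˣ →* ℂˣ)) (w : Equiv.Perm (Fin 3)) :
    (fun m : (Π a : Fin 3, GL {i : Fin 3 // (id : Fin 3 → Fin 3) i = a} F) => (((∏ a : Fin 3, ((fun a => θ (w.symm a)) a).comp ((Matrix.GeneralLinearGroup.det : GL {i : Fin 3 // (id : Fin 3 → Fin 3) i = a} F →* Fˣ).comp
      (Pi.evalMonoidHom (fun b : Fin 3 => GL {i : Fin 3 // (id : Fin 3 → Fin 3) i = b} F) a))) m : ℂˣ) : ℂ)) =
      (fun m : (Π a : Fin 3, GL {i : Fin 3 // (id : Fin 3 → Fin 3) i = a} F) => (((∏ a : Fin 3, ((![θ (w.symm 0), θ (w.symm 1), θ (w.symm 2)] : Fin 3 → (Fˣ →* ℂˣ)) a).comp (Matrix.GeneralLinearGroup.det.comp (Pi.evalMonoidHom (fun a : Fin 3 => GL {i : Fin 3 // (id : Fin 3 → Fin 3) i = a} F) a))) m : ℂˣ) : ℂ)) := by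
  funext m
  have h : (∏ a : Fin 3, (θ (w.symm a)).comp ((Matrix.GeneralLinearGroup.det : GL {i : Fin 3 // (id : Fin 3 → Fin 3) i = a} F →* Fˣ).comp
      (Pi.evalMonoidHom (fun b : Fin 3 => GL {i : Fin 3 // (id : Fin 3 → Fin 3) i = b} F) a))) =
      ∏ a : Fin 3, ((![θ (w.symm 0), θ (w.symm 1), θ (w.symm 2)] : Fin 3 → (Fˣ →* ℂˣ)) a).comp (Matrix.GeneralLinearGroup.det.comp
        (Pi.evalMonoidHom (fun a : Fin 3 => GL {i : Fin 3 // (id : Fin 3 → Fin 3) i = a} F) a)) :=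
    Finset.prod_congr rfl fun a _ => by fin_cases a <;> rfl
  simp only [h]

/-- The three reorderings of `θ_D″ = (a, aν, aν)`: `w = 1 ↦ (a,aν,aν)`, `w = s₂ ↦ (a,aν,aν)`, `w = s₁s₂ ↦ (aν,a,aν)`. [folklore] -/
theorem reorder_theta_D_high :
    (![(![(η * ((unramifiedTwist F (1 / 2) : QuasiChar F).toMonoidHom)⁻¹), (η * ((unramifiedTwist F (1 / 2) : QuasiChar F).toMonoidHom)), (η * ((unramifiedTwist F (1 / 2) : QuasiChar F).toMonoidHom))] : Fin 3 → (Fˣ →* ℂˣ)) ((1 : Equiv.Perm (Fin 3)).symm 0), (![(η * ((unramifiedTwist F (1 / 2) : QuasiChar F).toMonoidHom)⁻¹), (η * ((unramifiedTwist F (1 / 2) : QuasiChar F).toMonoidHom)), (η * ((unramifiedTwist F (1 / 2) : QuasiChar F).toMonoidHom))] : Fin 3 → (Fˣ →* ℂˣ)) ((1 : Equiv.Perm (Fin 3)).symm 1), (![(η * ((unramifiedTwist F (1 / 2) : QuasiChar F).toMonoidHom)⁻¹), (η * ((unramifiedTwist F (1 / 2) : QuasiChar F).toMonoidHom)), (η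 * ((unramifiedTwist F (1 / 2) : QuasiChar F).toMonoidHom))] : Fin 3 → (Fˣ →* ℂˣ)) ((1 : Equiv.Perm (Fin 3)).symm 2)] = ![(η * ((unramifiedTwist F (1 / 2) : QuasiChar F).toMonoidHom)⁻¹), (η * ((unramifiedTwist F (1 / 2) : QuasiChar F).toMonoidHom)), (η * ((unramifiedTwist F (1 / 2) : QuasiChar F).toMonoidHom))]) ∧
    (![(![(η * ((unramifiedTwist F (1 / 2) : QuasiChar F).toMonoidHom)⁻¹), (η * ((unramifiedTwist F (1 / 2) : QuasiChar F).toMonoidHom)), (η * ((unramifiedTwist F (1 / 2) : QuasiChar F).toMonoidHom))] : Fin 3 → (Fˣ →* ℂˣ)) ((Equiv.swap (1 : Fin 3) 2).symm 0), (![(η * ((unramifiedTwist F (1 / 2) : QuasiChar F).toMonoidHom)⁻¹), (η * ((unramifiedTwist F (1 / 2) : QuasiChar F).toMonoidHom)), (η * ((unramifiedTwist F (1 / 2) : QuasiChar F).toMonoidHom))] : Fin 3 → (Fˣ →* ℂˣ)) ((Equiv.swap (1 : Fin 3) 2).symm 1), (![(η * ((unramifiedTwist F (1 / 2) : QuasiChar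 F).toMonoidHom)⁻¹), (η * ((unramifiedTwist F (1 / 2) : QuasiChar F).toMonoidHom)), (η * ((unramifiedTwist F (1 / 2) : QuasiChar F).toMonoidHom))] : Fin 3 → (Fˣ →* ℂˣ)) ((Equiv.swap (1 : Fin 3) 2).symm 2)] = ![(η * ((unramifiedTwist F (1 / 2) : QuasiChar F).toMonoidHom)⁻¹), (η * ((unramifiedTwist F (1 / 2) : QuasiChar F).toMonoidHom)), (η * ((unramifiedTwist F (1 / 2) : QuasiChar F).toMonoidHom))]) ∧
    (![(![(η * ((unramifiedTwist F (1 / 2) : QuasiChar F).toMonoidHom)⁻¹), (η * ((unramifiedTwist F (1 / 2) : QuasiChar F).toMonoidHom)), (η * ((unramifiedTwist F (1 / 2) : QuasiChar F).toMonoidHom))] : Fin 3 → (Fˣ →* ℂˣ)) ((Equiv.swap (0 : Fin 3) 1 * Equiv.swap (1 : Fin 3) 2).symm 0), (![(η * ((unramifiedTwist F (1 / 2) : QuasiChar F).toMonoidHom)⁻¹), (η * ((unramifiedTwist F (1 / 2) : QuasiChar F).toMonoidHom)), (η * ((unramifiedTwist F (1 / 2) : QuasiChar F).toMonoidHom))]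 : Fin 3 → (Fˣ →* ℂˣ)) ((Equiv.swap (0 : Fin 3) 1 * Equiv.swap (1 : Fin 3) 2).symm 1),
      (![(η * ((unramifiedTwist F (1 / 2) : QuasiChar F).toMonoidHom)⁻¹), (η * ((unramifiedTwist F (1 / 2) : QuasiChar F).toMonoidHom)), (η * ((unramifiedTwist F (1 / 2) : QuasiChar F).toMonoidHom))] : Fin 3 → (Fˣ →* ℂˣ)) ((Equiv.swap (0 : Fin 3) 1 * Equiv.swap (1 : Fin 3) 2).symm 2)] = ![(η * ((unramifiedTwist F (1 / 2) : QuasiChar F).toMonoidHom)), (η * ((unramifiedTwist F (1 / 2) : QuasiChar F).toMonoidHom)⁻¹), (η * ((unramifiedTwist F (1 / 2) : QuasiChar F).toMonoidHom))]) := by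
  refine ⟨?_, ?_, ?_⟩
  · funext a; fin_cases a <;> simp [Equiv.Perm.one_def]
  · funext a; fin_cases a <;> simp [Equiv.symm_swap, Equiv.swap_apply_def]
  · funext a; fin_cases a <;> simp [Equiv.Perm.mul_def, Equiv.symm_swap, Equiv.swap_apply_def]

/-- `X ≠ Y` as weights (`a ≠ aν`, ★ REG). [folklore] -/
theorem tch_X_ne_Y : (fun m : (Π a : Fin 3, GL {i : Fin 3 // (id : Fin 3 → Fin 3) i = a} F) => (((∏ a : Fin 3, ((![(η * ((unramifiedTwist F (1 / 2) : QuasiChar F).toMonoidHom)⁻¹), (η * ((unramifiedTwist F (1 / 2) : QuasiChar F).toMonoidHom)), (η * ((unramifiedTwist F (1 / 2) : QuasiChar F).toMonoidHom))] : Fin 3 → (Fˣ →* ℂˣ)) a).comp (Matrix.GeneralLinearGroup.det.comp (Pi.evalMonoidHom (fun a : Fin 3 => GL {i : Fin 3 // (id : Fin 3 → Fin 3) i = a} F) a))) m : ℂˣ) : ℂ)) ≠ (fun m : (Π a : Fin 3, GL {i : Fin 3 // (id : Fin 3 → Fin 3) i = a} F) => (((∏ a : Fin 3, ((![(η * ((unramifiedTwist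 F (1 / 2) : QuasiChar F).toMonoidHom)), (η * ((unramifiedTwist F (1 / 2) : QuasiChar F).toMonoidHom)⁻¹), (η * ((unramifiedTwist F (1 / 2) : QuasiChar F).toMonoidHom))] : Fin 3 → (Fˣ →* ℂˣ)) a).comp (Matrix.GeneralLinearGroup.det.comp (Pi.evalMonoidHom (fun a : Fin 3 => GL {i : Fin 3 // (id : Fin 3 → Fin 3) i = a} F) a))) m : ℂˣ) : ℂ)) := fun h =>
  mul_nuHalf_inv_ne_mul_nuHalf η (by have h0 := congrFun (eq_of_tch_coe_eq _ _ h) 0; simpa using h0)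

open scoped Classical in
/-- **`E(D″) = {X², Y}`**: `r_U(D″)` is finite-dimensional and `mult D″ ζ = 2·[ζ = X] + [ζ = Y]` for every `ζ` (★ GEO-QB at `ψ = ην½`: the reorderings `w = 1, s₂` of `θ_D = (a,aν,aν)`
give `X`, `w = s₁s₂` gives `Y`). [cite: BernsteinZelevinsky1977, §2.12, Thm. 5.2] [cite: Zelevinsky1980, §1.2, Ex. 3.2] -/
theorem finrank_weightSpace_D_high (hη : IsOpen ((η.ker : Subgroup Fˣ) : Set Fˣ)) (ζ : (Π a : Fin 3, GL {i : Fin 3 // (id : Fin 3 → Fin 3) i = a} F) → ℂ) :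
    FiniteDimensional ℂ (restrictUnipotentGL F (id : Fin 3 → Fin 3) (Representation.parabolicIndGL F (![false, false, true] : Fin 3 → Bool) ((Representation.trivial ℂ (Π a : Bool, GL {i : Fin 3 // (![false, false, true] : Fin 3 → Bool) i = a} F) ℂ).twist ((η.comp (Matrix.GeneralLinearGroup.det.comp (Pi.evalMonoidHom (fun a : Bool => GL {i : Fin 3 // (![false, false, true] : Fin 3 → Bool) i = a} F) false))) * ((η * ((unramifiedTwist F (1 / 2) : QuasiChar F).toMonoidHom)).comp (Matrix.GeneralLinearGroup.det.comp (Pi.evalMonoidHom (fun a : Bool => GL {i : Fin 3 // (![false, false, true] : Fin 3 → Bool) i = a} F) true))))))).Coinvariants ∧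
    finrank ℂ ↥(⨅ m, Module.End.maxGenEigenspace (Representation.normalizedJacquetGL F (id : Fin 3 → Fin 3) (Representation.parabolicIndGL F (![false, false, true] : Fin 3 → Bool) ((Representation.trivial ℂ (Π a : Bool, GL {i : Fin 3 // (![false, false, true] : Fin 3 → Bool) i = a} F) ℂ).twist ((η.comp (Matrix.GeneralLinearGroup.det.comp (Pi.evalMonoidHom (fun a : Bool => GL {i : Fin 3 // (![false, false, true] : Fin 3 → Bool) i = a} F) false))) * ((η * ((unramifiedTwist F (1 / 2) : QuasiChar F).toMonoidHom)).comp (Matrix.GeneralLinearGroup.det.comp (Pi.evalMonoidHom (fun a : Bool => GL {i : Fin 3 // (![false, false, true] : Fin 3 → Bool) i = a} F) true)))))) m) (ζ m)) = (if ζ = (fun m : (Π a : Fin 3, GL {i : Fin 3 // (id : Fin 3 → Fin 3) i = a} F) => (((∏ a : Fin 3, ((![(η * ((unramifiedTwist F (1 / 2) : QuasiChar F).toMonoidHom)⁻¹), (η * ((unramifiedTwist F (1 / 2) : QuasiChar F).toMonoidHom)), (η * ((unramifiedTwist F (1 / 2) : QuasiChar F).toMonoidHom))] : Fin 3 → (Fˣ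 →* ℂˣ)) a).comp (Matrix.GeneralLinearGroup.det.comp (Pi.evalMonoidHom (fun a : Fin 3 => GL {i : Fin 3 // (id : Fin 3 → Fin 3) i = a} F) a))) m : ℂˣ) : ℂ)) then 2 else 0) + (if ζ = (fun m : (Π a : Fin 3, GL {i : Fin 3 // (id : Fin 3 → Fin 3) i = a} F) => (((∏ a : Fin 3, ((![(η * ((unramifiedTwist F (1 / 2) : QuasiChar F).toMonoidHom)), (η * ((unramifiedTwist F (1 / 2) : QuasiChar F).toMonoidHom)⁻¹), (η * ((unramifiedTwist F (1 / 2) : QuasiChar F).toMonoidHom))] : Fin 3 → (Fˣ →* ℂˣ)) a).comp (Matrix.GeneralLinearGroup.det.comp (Pi.evalMonoidHom (fun a : Fin 3 => GL {i : Fin 3 // (id : Fin 3 → Fin 3) i = a} F) a))) m : ℂˣ) : ℂ)) then 1 else 0) := by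
  have hh := finrank_weightSpace_normalizedJacquetGL_D η (η * ((unramifiedTwist F (1 / 2) : QuasiChar F).toMonoidHom)) hη (isOpen_ker_b η hη) ζ
  refine ⟨hh.1, ?_⟩
  have h := hh.2
  rw [h]
  have h123 := reorder_theta_D_high η
  have h1 := h123.1
  have h2 := h123.2.1
  have h3 := h123.2.2
  have e1 := tch_reorder_eq (![(η * ((unramifiedTwist F (1 / 2) : QuasiChar F).toMonoidHom)⁻¹), (η * ((unramifiedTwist F (1 / 2) : QuasiChar F).toMonoidHom)), (η * ((unramifiedTwist F (1 / 2) : QuasiChar F).toMonoidHom))] : Fin 3 → (Fˣ →* ℂˣ)) (1 : Equiv.Perm (Fin 3))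
  have e2 := tch_reorder_eq (![(η * ((unramifiedTwist F (1 / 2) : QuasiChar F).toMonoidHom)⁻¹), (η * ((unramifiedTwist F (1 / 2) : QuasiChar F).toMonoidHom)), (η * ((unramifiedTwist F (1 / 2) : QuasiChar F).toMonoidHom))] : Fin 3 → (Fˣ →* ℂˣ)) (Equiv.swap (1 : Fin 3) 2)
  have e3 := tch_reorder_eq (![(η * ((unramifiedTwist F (1 / 2) : QuasiChar F).toMonoidHom)⁻¹), (η * ((unramifiedTwist F (1 / 2) : QuasiChar F).toMonoidHom)), (η * ((unramifiedTwist F (1 / 2) : QuasiChar F).toMonoidHom))] : Fin 3 → (Fˣ →* ℂˣ)) (Equiv.swap (0 : Fin 3) 1 * Equiv.swap (1 : Fin 3) 2)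
  rw [h1] at e1
  rw [h2] at e2
  rw [h3] at e3
  have hs : (1 : Equiv.Perm (Fin 3)) ≠ Equiv.swap (1 : Fin 3) 2 := by decide
  have hXY := tch_X_ne_Y η
  simp only [Finset.filter_insert, Finset.filter_singleton, e1, e2, e3]
  by_cases hX : ζ = (fun m : (Π a : Fin 3, GL {i : Fin 3 // (id : Fin 3 → Fin 3) i = a} F) => (((∏ a : Fin 3, ((![(η * ((unramifiedTwist F (1 / 2) : QuasiChar F).toMonoidHom)⁻¹), (η * ((unramifiedTwist F (1 / 2) : QuasiChar F).toMonoidHom)), (η * ((unramifiedTwist F (1 / 2) : QuasiChar F).toMonoidHom))] : Fin 3 → (Fˣ →* ℂˣ)) a).comp (Matrix.GeneralLinearGroup.det.comp (Pi.evalMonoidHom (fun a : Fin 3 => GL {i : Fin 3 // (id : Fin 3 → Fin 3) i = a} F) a))) m : ℂˣ) : ℂ))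
  · have hY : ¬ ζ = (fun m : (Π a : Fin 3, GL {i : Fin 3 // (id : Fin 3 → Fin 3) i = a} F) => (((∏ a : Fin 3, ((![(η * ((unramifiedTwist F (1 / 2) : QuasiChar F).toMonoidHom)), (η * ((unramifiedTwist F (1 / 2) : QuasiChar F).toMonoidHom)⁻¹), (η * ((unramifiedTwist F (1 / 2) : QuasiChar F).toMonoidHom))] : Fin 3 → (Fˣ →* ℂˣ)) a).comp (Matrix.GeneralLinearGroup.det.comp (Pi.evalMonoidHom (fun a : Fin 3 => GL {i : Fin 3 // (id : Fin 3 → Fin 3) i = a} F) a))) m : ℂˣ) : ℂ)) := fun h' => hXY (hX.symm.trans h')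
    rw [if_pos hX, if_pos hX, if_neg hY, if_pos hX, if_neg hY, Finset.card_insert_of_notMem (by simpa using hs)]
    simp
  · by_cases hY : ζ = (fun m : (Π a : Fin 3, GL {i : Fin 3 // (id : Fin 3 → Fin 3) i = a} F) => (((∏ a : Fin 3, ((![(η * ((unramifiedTwist F (1 / 2) : QuasiChar F).toMonoidHom)), (η * ((unramifiedTwist F (1 / 2) : QuasiChar F).toMonoidHom)⁻¹), (η * ((unramifiedTwist F (1 / 2) : QuasiChar F).toMonoidHom))] : Fin 3 → (Fˣ →* ℂˣ)) a).comp (Matrix.GeneralLinearGroup.det.comp (Pi.evalMonoidHom (fun a : Fin 3 => GL {i : Fin 3 // (id : Fin 3 → Fin 3) i = a} F) a))) m : ℂˣ) : ℂ))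
    · rw [if_neg hX, if_neg hX, if_pos hY, if_neg hX, if_pos hY]
      simp
    · rw [if_neg hX, if_neg hX, if_neg hY, if_neg hX, if_neg hY]
      simp

end Summit.HodgeConjecture.HodgeConjecture.Cruxes.H413.K2E3GL3OneLinkNestedHighPieces

end
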